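import Mathlib.RingTheory.Smooth.Field
import Mathlib.RingTheory.LocalRing.ResidueField.Ideal
import Mathlib.FieldTheory.SeparableClosure
import Mathlib.RingTheory.MvPolynomial.Homogeneous
import Literature.RingTheory.HilbertSamuel.ProjDirectrixChart
import HarnessLib

/-!
# [OURS · L1 W4.2] The residue field of the homogeneous prime `𝔭_{x'}` of a point with SEPARABLE ALGEBRAIC residue field
# extension is formally smooth over `κ(x)` — the input of Theorem IV at separable closed points of the fibre
# (campaign s42, cell res-hironaka; `--supports` stmt-ResolutionOfSingularities-17845)

HONEST FRAMING. OURS (slot W4.2, prover res-L1-s42-pv-1, gen 7). Companion of `…CampaignW42SymbolicPowerFrobenius` /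
`…CampaignW42ThmIVOfFormallySmooth`: there, Hironaka's THEOREM IV is proved at every near point `x'` whose cone-point residue
field `κ(𝔭_{x'})` (the residue field of `κ(x)[X_1, …, X_m]` at the homogeneous prime `𝔭_{x'} = chartPrime` of the point) is
formally smooth over `κ(x)`. This file supplies that hypothesis in the second natural case (the first being `κ(x)` perfect):

* **`formallySmooth_residueField_chartPrime_of_isSeparable`** — for a local homomorphism `φ : A → B`, chart data
  `u : Fin m → B` with some `X_{i₀} ∉ 𝔭 := chartPrime φ u` (the point is a point of `ℙ`, automatic for blow-up charts), and
  `κ(B)` SEPARABLE ALGEBRAIC over `κ(A)` (through `κ(φ)`), the residue field `κ(𝔭)` is formally smooth over `κ(A)`.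

PROOF. In `κ(𝔭)` let `X̄_j` be the classes of the variables and `Z = X̄_{i₀} ≠ 0`. (i) `Z` is transcendental over `K = κ(A)`:
a relation `p(X_{i₀}) ∈ 𝔭` has all its homogeneous components `c_k X_{i₀}^k` in the homogeneous prime `𝔭 ∌ X_{i₀}`, so `p = 0`
(`eq_zero_of_aeval_X_mem`). (ii) each `a_j = X̄_j / Z` is separable algebraic over `K`: the minimal polynomial `f` of
`ū_j/ū_{i₀} ∈ κ(B)` homogenises to a form `F = Σ_k f_k X_j^k X_{i₀}^{d−k}` killed by the chart evaluation, so `F ∈ 𝔭`,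
so `Z^d f(a_j) = F(X̄) = 0` in `κ(𝔭)`. (iii) `κ(𝔭) = Frac(S/𝔭)` is generated over `K(Z)` by the `X̄_j = a_j Z`, hence is
separable algebraic over `K(Z)`; Mathlib's `Algebra.FormallySmooth.of_algebraicIndependent_of_isSeparable` concludes.
Pure commutative algebra; no scheme. NOT a statement of any source (orientation: B. Dietel, Dissertation Regensburg (2015),
Prop. (9.2.6): Hironaka schemes under separable base change). AI-written; AI review is weaker than expert review.
-/

noncomputable section

-- single-conjunct summit: the doubled namespace component `ResolutionOfSingularities` is mandated
set_option linter.dupNamespace false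

open IsLocalRing MvPolynomial
open Literature.RingTheory.HilbertSamuel

namespace Summit.ResolutionOfSingularities.ResolutionOfSingularities.Theorems

namespace CampaignW42

universe u v w

/-! ## Homogeneous primes missing a variable: the variable is transcendental in the residue field -/

section Transcendental

variable {K : Type u} [Field K] {m : ℕ}

/-- In a homogeneous prime `𝔭 ∌ X_{i₀}` of `K[X_1, …, X_m]`, a one-variable relation `p(X_{i₀}) ∈ 𝔭` forces `p = 0`
(the top homogeneous component `c X_{i₀}^k` of `p(X_{i₀})` would lie in `𝔭`). [folklore] -/
theorem eq_zero_of_aeval_X_mem {𝔭 : Ideal (MvPolynomial (Fin m) K)} [h𝔭 : 𝔭.IsPrime]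
    (hhom : ∀ f ∈ 𝔭, ∀ d : ℕ, homogeneousComponent d f ∈ 𝔭) {i₀ : Fin m}
    (hi₀ : (X i₀ : MvPolynomial (Fin m) K) ∉ 𝔭) (p : Polynomial K)
    (hp : Polynomial.aeval (X i₀ : MvPolynomial (Fin m) K) p ∈ 𝔭) : p = 0 := by
  classical
  by_contra hp0
  have hcomp : homogeneousComponent p.natDegree (Polynomial.aeval (X i₀ : MvPolynomial (Fin m) K) p) =
      p.coeff p.natDegree • X i₀ ^ p.natDegree := by
    rw [Polynomial.aeval_eq_sum_range, map_sum, Finset.sum_eq_single p.natDegree]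
    · rw [homogeneousComponent_of_mem (Submodule.smul_mem _ _
        ((mem_homogeneousSubmodule _ _).mpr (isHomogeneous_X_pow i₀ p.natDegree))), if_pos rfl]
    · intro i _ hik
      rw [homogeneousComponent_of_mem (Submodule.smul_mem _ _
        ((mem_homogeneousSubmodule _ _).mpr (isHomogeneous_X_pow i₀ i))), if_neg (Ne.symm hik)]
    · intro hk
      exact absurd (Finset.self_mem_range_succ p.natDegree) hk
  have hmem : p.coeff p.natDegree • (X i₀ : MvPolynomial (Fin m) K) ^ p.natDegree ∈ 𝔭 :=
    hcomp ▸ hhom _ hp p.natDegree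
  have hc : p.coeff p.natDegree ≠ 0 := Polynomial.leadingCoeff_ne_zero.mpr hp0
  rw [smul_eq_C_mul] at hmem
  have hX : (X i₀ : MvPolynomial (Fin m) K) ^ p.natDegree ∈ 𝔭 :=
    (h𝔭.mem_or_mem hmem).resolve_left fun h =>
      h𝔭.ne_top (Ideal.eq_top_of_isUnit_mem _ h ((isUnit_iff_ne_zero.mpr hc).map C))
  exact hi₀ (h𝔭.mem_of_pow_mem _ hX)

end Transcendental

/-! ## Homogenisation of a one-variable polynomial in two of the variables -/

section Homogenise

variable {K : Type u} [Field K] {m : ℕ}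

/-- The form `Σ_{k ≤ d} f_k X_j^k X_{i₀}^{d−k}` is homogeneous of degree `d`. [folklore] -/
theorem isHomogeneous_homogenise (f : Polynomial K) (j i₀ : Fin m) (d : ℕ) :
    (∑ k ∈ Finset.range (d + 1), C (f.coeff k) * X j ^ k * X i₀ ^ (d - k) :
      MvPolynomial (Fin m) K).IsHomogeneous d := by
  refine IsHomogeneous.sum _ _ _ fun k hk => ?_
  have hkd : k ≤ d := Nat.lt_succ_iff.mp (Finset.mem_range.mp hk)
  have h := ((isHomogeneous_C (Fin m) (f.coeff k)).mul (isHomogeneous_X_pow j k)).mul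
    (isHomogeneous_X_pow i₀ (d - k))
  have hdeg : 0 + k + (d - k) = d := by omega
  exact (congrArg (MvPolynomial.IsHomogeneous (C (f.coeff k) * X j ^ k * X i₀ ^ (d - k))) hdeg).mp h

/-- Evaluation of the homogenised form: `F(v) = Σ_k f_k v_j^k v_{i₀}^{d−k}`. [folklore] -/
theorem aeval_homogenise {R : Type w} [CommRing R] [Algebra K R] (f : Polynomial K) (j i₀ : Fin m) (d : ℕ)
    (v : Fin m → R) :
    aeval v (∑ k ∈ Finset.range (d + 1), C (f.coeff k) * X j ^ k * X i₀ ^ (d - k) : MvPolynomial (Fin m) K) =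
      ∑ k ∈ Finset.range (d + 1), f.coeff k • (v j ^ k * v i₀ ^ (d - k)) := by
  rw [map_sum]
  refine Finset.sum_congr rfl fun k _ => ?_
  rw [map_mul, map_mul, map_pow, map_pow, aeval_X, aeval_X, aeval_C, Algebra.smul_def, mul_assoc]

/-- Dehomogenisation in a field: `Σ_{k ≤ d} f_k y^k z^{d−k} = z^d · f(y/z)` for `z ≠ 0` and `deg f ≤ d`. [folklore] -/
theorem sum_coeff_smul_eq_pow_mul_aeval_div {F : Type w} [Field F] [Algebra K F] (f : Polynomial K) {d : ℕ}
    (hd : f.natDegree < d + 1) (y z : F) (hz : z ≠ 0) :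
    ∑ k ∈ Finset.range (d + 1), f.coeff k • (y ^ k * z ^ (d - k)) = z ^ d * Polynomial.aeval (y / z) f := by
  rw [Polynomial.aeval_eq_sum_range' hd, Finset.mul_sum]
  refine Finset.sum_congr rfl fun k hk => ?_
  have hkd : k ≤ d := Nat.lt_succ_iff.mp (Finset.mem_range.mp hk)
  have hzk : z ^ k ≠ 0 := pow_ne_zero _ hz
  rw [Algebra.smul_def, Algebra.smul_def, div_pow,
    show z ^ d = z ^ (d - k) * z ^ k by rw [← pow_add, Nat.sub_add_cancel hkd]]
  field_simp

end Homogenise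

/-! ## The residue field of `chartPrime` at a separable algebraic point is formally smooth -/

section Chart

variable {A : Type u} [CommRing A] [IsLocalRing A] {B : Type w} [CommRing B] [IsLocalRing B]
  (φ : A →+* B) [IsLocalHom φ] {m : ℕ} (u : Fin m → B)

/-- **The residue field `κ(𝔭_{x'})` of the homogeneous prime of a point with separable algebraic residue field
extension is formally smooth over `κ(A)`.** Data: a local homomorphism `φ : A → B`, `u : Fin m → B` with
`X_{i₀} ∉ 𝔭 := chartPrime φ u` for some `i₀`, and `κ(B)` separable algebraic over `κ(A)` through `κ(φ)`. Then
`Algebra.FormallySmooth κ(A) κ(𝔭)` (`κ(𝔭) = (chartPrime φ u).ResidueField`): `κ(𝔭) = K(Z)(a_1, …, a_m)` with `Z = X̄_{i₀}`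
transcendental and `a_j = X̄_j/Z` separable algebraic over `K`. [cite: Dietel2015, Prop. (9.2.6) p. 112–113] -/
theorem formallySmooth_residueField_chartPrime_of_isSeparable (i₀ : Fin m) (hi₀ : X i₀ ∉ chartPrime φ u)
    (hsep : letI : Algebra (ResidueField A) (ResidueField B) := (ResidueField.map φ).toAlgebra
      Algebra.IsSeparable (ResidueField A) (ResidueField B)) :
    haveI := isPrime_chartPrime φ u
    Algebra.FormallySmooth (ResidueField A) (chartPrime φ u).ResidueField := by
  classical
  letI algKL : Algebra (ResidueField A) (ResidueField B) := (ResidueField.map φ).toAlgebra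
  haveI h𝔭 := isPrime_chartPrime φ u
  haveI := hsep
  -- notation-free abbreviations
  let K := ResidueField A
  let S := MvPolynomial (Fin m) (ResidueField A)
  let 𝔭 : Ideal S := chartPrime φ u
  let κ := 𝔭.ResidueField
  let ρ : S →ₐ[K] κ := IsScalarTower.toAlgHom K S κ
  have hρ : ∀ a : S, ρ a = 0 ↔ a ∈ 𝔭 := fun a => Ideal.algebraMap_residueField_eq_zero (I := 𝔭)
  let Xb : Fin m → κ := fun j => ρ (X j)
  have hρX : ρ = aeval Xb := MvPolynomial.algHom_ext fun j => by simp [Xb]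
  -- the distinguished variable `Z = X̄_{i₀} ≠ 0`
  have hZ : Xb i₀ ≠ 0 := fun h => hi₀ ((hρ _).mp h)
  -- `ū_{i₀} ≠ 0` in `κ(B)`
  let ub : Fin m → ResidueField B := fun j => residue B (u j)
  have hchart : ∀ f : S, chartEval φ u f = aeval ub f := fun f => rfl
  have hu₀ : ub i₀ ≠ 0 := by
    intro h
    apply hi₀
    rw [mem_chartPrime_iff_of_isHomogeneous φ u (isHomogeneous_X _ i₀), hchart, aeval_X]
    exact h
  -- (i) `Z` is transcendental over `K`
  have hZtr : Transcendental K (Xb i₀) := by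
    rw [transcendental_iff]
    intro p hp
    refine eq_zero_of_aeval_X_mem (fun f hf d => homogeneousComponent_mem_chartPrime φ u hf d) hi₀ p ?_
    rw [← hρ, ← Polynomial.aeval_algHom_apply]
    exact hp
  have hZind : AlgebraicIndependent K ![Xb i₀] := algebraicIndependent_iff_transcendental.mpr hZtr
  -- (ii) the affine coordinates `a_j = X̄_j / Z` are separable algebraic over `K`
  have hsepa : ∀ j, IsSeparable K (Xb j / Xb i₀) := by
    intro j
    set f := minpoly K (ub j / ub i₀) with hf
    set d := f.natDegree with hd
    have hfsep : f.Separable := Algebra.IsSeparable.isSeparable K (ub j / ub i₀)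
    -- the homogenised form lies in `𝔭`
    have hF : (∑ k ∈ Finset.range (d + 1), C (f.coeff k) * X j ^ k * X i₀ ^ (d - k) : S) ∈ 𝔭 := by
      rw [mem_chartPrime_iff_of_isHomogeneous φ u (isHomogeneous_homogenise f j i₀ d), hchart, aeval_homogenise,
        sum_coeff_smul_eq_pow_mul_aeval_div f (Nat.lt_succ_self d) _ _ hu₀, minpoly.aeval, mul_zero]
    -- hence `Z^d f(a_j) = 0`
    have hzero : Xb i₀ ^ d * Polynomial.aeval (Xb j / Xb i₀) f = 0 := by
      rw [← sum_coeff_smul_eq_pow_mul_aeval_div f (Nat.lt_succ_self d) _ _ hZ, ← aeval_homogenise, ← hρX]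
      exact (hρ _).mpr hF
    have haj : Polynomial.aeval (Xb j / Xb i₀) f = 0 :=
      (mul_eq_zero.mp hzero).resolve_left (pow_ne_zero _ hZ)
    exact hfsep.of_dvd (minpoly.dvd K _ haj)
  -- (iii) `κ(𝔭)` is separable algebraic over `E = K(Z)`
  let E := IntermediateField.adjoin K (Set.range ![Xb i₀])
  have hZE : Xb i₀ ∈ E := IntermediateField.subset_adjoin K _ ⟨0, rfl⟩
  haveI : Algebra.IsSeparable E κ := by
    -- everything lies in the separable closure of `E` in `κ`
    have hXb : ∀ j, Xb j ∈ separableClosure E κ := by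
      intro j
      have hprod : Xb j = (Xb j / Xb i₀) * Xb i₀ := (div_mul_cancel₀ (Xb j) hZ).symm
      rw [hprod]
      refine mul_mem ?_ ?_
      · exact mem_separableClosure_iff.mpr ((hsepa j).tower_top E)
      · have : Xb i₀ = algebraMap E κ ⟨Xb i₀, hZE⟩ := rfl
        rw [this]
        exact mem_separableClosure_iff.mpr (isSeparable_algebraMap _)
    have hρmem : ∀ a : S, ρ a ∈ separableClosure E κ := by
      intro a
      induction a using MvPolynomial.induction_on with
      | C c =>
        have : ρ (C c) = algebraMap E κ (algebraMap K E c) := by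
          rw [← IsScalarTower.algebraMap_apply K E κ c]
          change algebraMap S κ (C c) = algebraMap K κ c
          rw [← MvPolynomial.algebraMap_eq]
          exact (IsScalarTower.algebraMap_apply K S κ c).symm
        rw [this]
        exact mem_separableClosure_iff.mpr (isSeparable_algebraMap _)
      | add p q hp hq => rw [map_add]; exact add_mem hp hq
      | mul_X p n hp => rw [map_mul]; exact mul_mem hp (hXb n)
    refine ⟨fun x => ?_⟩
    obtain ⟨a, b, hb, rfl⟩ := IsFractionRing.div_surjective (A := S ⧸ 𝔭) x
    obtain ⟨a, rfl⟩ := Ideal.Quotient.mk_surjective a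
    obtain ⟨b, rfl⟩ := Ideal.Quotient.mk_surjective b
    rw [Ideal.algebraMap_quotient_residueField_mk, Ideal.algebraMap_quotient_residueField_mk]
    exact mem_separableClosure_iff.mp (div_mem (hρmem a) (hρmem b))
  exact Algebra.FormallySmooth.of_algebraicIndependent_of_isSeparable hZind

end Chart

end CampaignW42

end Summit.ResolutionOfSingularities.ResolutionOfSingularities.Theorems

end
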